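import Mathlib
import HarnessLib

/-!
# Cut domination on the hypercube (crux `RankDefectRepresentations`, stmt-PneNP-18923; line `rank-dehn-ladder`, rung N1)

For every normalised monotone submodular `h` on the subsets of the cube `Q_n = (Fin n → Bool)` and every `B ⊆ Q_n`,

  `h B + h Bᶜ + (n - 1) · h Q_n ≤ ∑_j (h {σ | σ j = false} + h {σ | σ j = true})`,

i.e. the connectivity `λ(B) = h B + h Bᶜ - h Q_n` of ANY bipartition is dominated by the sum of the `n` coordinate
("dimension") cuts.  (Information form: `I(Y_B ; Y_{Bᶜ}) ≤ ∑_j I(Y_{σ_j = 0} ; Y_{σ_j = 1})` for random variables indexed by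
the cube.)  Proof: induction on `n`, applying the hypothesis to the restriction to a half-cube and to the polymatroid
conditioned on the other half-cube, then symmetrising.  This is Theorem 1 of the lead-g7 proof of the cut lemma
(`Cruxes/RankDefectRepresentations/Lines/rank-dehn-ladder-N1-proof.md`); the matrix corollaries (every bipartition cut of a
cube-coloured matrix has rank at most the sum of the coordinate-cut ranks; the additive cut inequality (A)) follow in
`…CutLemmaCutDominationMatrix`.
HONEST FRAMING: a tool on the negative lane of the crux; P ≠ NP is not moved; F-N2 is a FRONTIER formal rung.
-/

set_option linter.dupNamespace false -- `Summit.PneNP.PneNP.…`: summit = sub-problem name (D-0017)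

namespace Summit.PneNP.PneNP.Theorems.CnfIdealGenLengthRankDefectRepresentationsCutLemmaCutDomination

open Finset

/-- `Fin.cons b` is injective in the tail. [folklore] -/
theorem cons_injective (n : ℕ) (b : Bool) :
    Function.Injective (fun x : Fin n → Bool => (Fin.cons b x : Fin (n + 1) → Bool)) := by
  intro x y hxy
  have := congrArg Fin.tail hxy
  simpa using this

/-- One half of the inductive step of `cut_domination`: the estimate obtained from the induction hypothesis applied to the
restriction to the half-cube `σ 0 = b` and to the polymatroid conditioned on that half-cube. [folklore] -/
theorem cut_domination_step (n : ℕ)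
    (ih : ∀ (h : Finset (Fin n → Bool) → ℤ), h ∅ = 0 → (∀ A A', A ⊆ A' → h A ≤ h A') →
      (∀ A A', h (A ∪ A') + h (A ∩ A') ≤ h A + h A') → ∀ B : Finset (Fin n → Bool),
      h B + h Bᶜ + ((n : ℤ) - 1) * h univ ≤
        ∑ j : Fin n, (h (univ.filter fun σ => σ j = false) + h (univ.filter fun σ => σ j = true)))
    (h : Finset (Fin (n + 1) → Bool) → ℤ) (h0 : h ∅ = 0) (hmono : ∀ A A', A ⊆ A' → h A ≤ h A')
    (hsub : ∀ A A', h (A ∪ A') + h (A ∩ A') ≤ h A + h A') (B : Finset (Fin (n + 1) → Bool)) (b : Bool) :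
    let e : Bool → (Fin n → Bool) ↪ (Fin (n + 1) → Bool) :=
      fun c => ⟨fun x => (Fin.cons c x : Fin (n + 1) → Bool), cons_injective n c⟩
    h ((univ.filter fun x => e b x ∈ B).map (e b)) + h ((univ.filter fun x => e b x ∉ B).map (e b)) +
      h ((univ.filter fun x => e (!b) x ∈ B).map (e (!b)) ∪ univ.map (e b)) +
      h ((univ.filter fun x => e (!b) x ∉ B).map (e (!b)) ∪ univ.map (e b)) -
      2 * h (univ.map (e b)) + ((n : ℤ) - 1) * h univ ≤
      ∑ j : Fin n, (h (univ.filter fun σ => σ j.succ = false) + h (univ.filter fun σ => σ j.succ = true)) := by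
  intro e
  set Q : Finset (Fin (n + 1) → Bool) := univ.map (e b) with hQ
  -- the restricted polymatroid
  set h₀ : Finset (Fin n → Bool) → ℤ := fun S => h (S.map (e b)) with hh₀
  -- the conditioned polymatroid
  set g : Finset (Fin n → Bool) → ℤ := fun S => h (S.map (e (!b)) ∪ Q) - h Q with hg
  have h₀0 : h₀ ∅ = 0 := by simp [hh₀, h0]
  have h₀mono : ∀ A A', A ⊆ A' → h₀ A ≤ h₀ A' := fun A A' hA => hmono _ _ (map_subset_map.mpr hA)
  have h₀sub : ∀ A A', h₀ (A ∪ A') + h₀ (A ∩ A') ≤ h₀ A + h₀ A' := by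
    intro A A'
    simp only [hh₀, map_union, map_inter]
    exact hsub _ _
  have g0 : g ∅ = 0 := by simp [hg]
  have gmono : ∀ A A', A ⊆ A' → g A ≤ g A' := by
    intro A A' hA
    simp only [hg]
    have := hmono (A.map (e (!b)) ∪ Q) (A'.map (e (!b)) ∪ Q)
      (union_subset_union (map_subset_map.mpr hA) le_rfl)
    linarith
  have gsub : ∀ A A', g (A ∪ A') + g (A ∩ A') ≤ g A + g A' := by
    intro A A'
    simp only [hg, map_union, map_inter]
    have e1 : A.map (e (!b)) ∪ A'.map (e (!b)) ∪ Q = (A.map (e (!b)) ∪ Q) ∪ (A'.map (e (!b)) ∪ Q) := by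
      ext σ; simp only [mem_union]; tauto
    have e2 : A.map (e (!b)) ∩ A'.map (e (!b)) ∪ Q = (A.map (e (!b)) ∪ Q) ∩ (A'.map (e (!b)) ∪ Q) := by
      ext σ; simp only [mem_union, mem_inter]; tauto
    rw [e1, e2]
    have := hsub (A.map (e (!b)) ∪ Q) (A'.map (e (!b)) ∪ Q)
    linarith
  -- the two instances of the induction hypothesis
  have I1 := ih h₀ h₀0 h₀mono h₀sub (univ.filter fun x => e b x ∈ B)
  have I2 := ih g g0 gmono gsub (univ.filter fun x => e (!b) x ∈ B)
  -- complements inside the small cube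
  have c1 : (univ.filter fun x => e b x ∈ B)ᶜ = univ.filter fun x => e b x ∉ B := by
    ext x; simp
  have c2 : (univ.filter fun x => e (!b) x ∈ B)ᶜ = univ.filter fun x => e (!b) x ∉ B := by
    ext x; simp
  rw [c1] at I1
  rw [c2] at I2
  -- `Q ∪ (other half) = univ`
  have hQQ : (univ : Finset (Fin n → Bool)).map (e (!b)) ∪ Q = univ := by
    apply eq_univ_of_forall
    intro σ
    rcases Bool.eq_false_or_eq_true (σ 0) with hσ | hσ <;> rcases Bool.eq_false_or_eq_true b with hb | hb
    all_goals
      simp only [mem_union, mem_map, mem_univ, true_and, hQ]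
    · right; exact ⟨Fin.tail σ, by ext i; refine Fin.cases ?_ (fun i => ?_) i <;> simp [e, hσ, hb, Fin.tail]⟩
    · left; exact ⟨Fin.tail σ, by ext i; refine Fin.cases ?_ (fun i => ?_) i <;> simp [e, hσ, hb, Fin.tail]⟩
    · left; exact ⟨Fin.tail σ, by ext i; refine Fin.cases ?_ (fun i => ?_) i <;> simp [e, hσ, hb, Fin.tail]⟩
    · right; exact ⟨Fin.tail σ, by ext i; refine Fin.cases ?_ (fun i => ?_) i <;> simp [e, hσ, hb, Fin.tail]⟩
  -- per-coordinate comparison of the induction terms with the big-cube half-spaces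
  have percoord : ∀ (j : Fin n) (δ : Bool),
      h₀ (univ.filter fun x => x j = δ) + g (univ.filter fun x => x j = δ) ≤
        h (univ.filter fun σ => σ j.succ = δ) := by
    intro j δ
    set X : Finset (Fin (n + 1) → Bool) := univ.filter fun σ => σ j.succ = δ with hX
    have m1 : h₀ (univ.filter fun x => x j = δ) ≤ h (X ∩ Q) := by
      apply hmono
      intro σ hσ
      simp only [mem_map, mem_filter, mem_univ, true_and] at hσ
      obtain ⟨x, hx, rfl⟩ := hσ
      simp only [mem_inter, hX, mem_filter, mem_univ, true_and, hQ, mem_map]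
      exact ⟨by simpa [e] using hx, ⟨x, rfl⟩⟩
    have m2 : h ((univ.filter fun x => x j = δ).map (e (!b)) ∪ Q) ≤ h (X ∪ Q) := by
      apply hmono
      apply union_subset_union _ le_rfl
      intro σ hσ
      simp only [mem_map, mem_filter, mem_univ, true_and] at hσ
      obtain ⟨x, hx, rfl⟩ := hσ
      simp only [hX, mem_filter, mem_univ, true_and]
      simpa [e] using hx
    have s := hsub X Q
    simp only [hg]
    linarith
  have sumcmp : ∑ j : Fin n, (h₀ (univ.filter fun x => x j = false) + h₀ (univ.filter fun x => x j = true)) +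
      ∑ j : Fin n, (g (univ.filter fun x => x j = false) + g (univ.filter fun x => x j = true)) ≤
      ∑ j : Fin n, (h (univ.filter fun σ => σ j.succ = false) + h (univ.filter fun σ => σ j.succ = true)) := by
    rw [← sum_add_distrib]
    apply sum_le_sum
    intro j _
    have := percoord j false
    have := percoord j true
    linarith
  -- unfold the small sides
  have hguniv : g univ = h univ - h Q := by simp only [hg, hQQ]
  simp only [hh₀, hg] at I1 I2 sumcmp
  rw [hQQ] at I2
  have : ((univ : Finset (Fin n → Bool)).map (e b)) = Q := rfl
  linarith [I1, I2, sumcmp]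

/-- **Cut domination on the hypercube.**  For a normalised, monotone, submodular `h : Finset (Fin n → Bool) → ℤ` and any
`B`, the connectivity of the bipartition `(B, Bᶜ)` is at most the sum of the connectivities of the `n` coordinate bipartitions:
`h B + h Bᶜ + (n - 1) · h univ ≤ ∑_j (h {σ_j = false} + h {σ_j = true})`. [folklore] -/
theorem cut_domination (n : ℕ) :
    ∀ (h : Finset (Fin n → Bool) → ℤ), h ∅ = 0 → (∀ A A', A ⊆ A' → h A ≤ h A') →
      (∀ A A', h (A ∪ A') + h (A ∩ A') ≤ h A + h A') → ∀ B : Finset (Fin n → Bool),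
      h B + h Bᶜ + ((n : ℤ) - 1) * h univ ≤
        ∑ j : Fin n, (h (univ.filter fun σ => σ j = false) + h (univ.filter fun σ => σ j = true)) := by
  induction n with
  | zero =>
      intro h h0 hmono hsub B
      simp only [Nat.cast_zero, zero_sub, neg_mul, one_mul, univ_eq_empty, sum_empty]
      -- `Fin 0 → Bool` has exactly one element, so `B = ∅` or `B = univ`
      rcases B.eq_empty_or_nonempty with hB | ⟨σ, hσ⟩
      · subst hB; simp [h0]
      · have hB : B = univ := by
          apply eq_univ_of_forall
          intro τ
          have : τ = σ := Subsingleton.elim _ _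
          rw [this]; exact hσ
        subst hB
        rw [Finset.compl_univ, h0]
        linarith
  | succ n ih =>
      intro h h0 hmono hsub B
      have E0 := cut_domination_step n ih h h0 hmono hsub B false
      have E1 := cut_domination_step n ih h h0 hmono hsub B true
      simp only [Bool.not_false, Bool.not_true] at E0 E1
      set e : Bool → (Fin n → Bool) ↪ (Fin (n + 1) → Bool) :=
        fun c => ⟨fun x => (Fin.cons c x : Fin (n + 1) → Bool), cons_injective n c⟩ with he
      set B0 := (univ.filter fun x => e false x ∈ B).map (e false)
      set Bc0 := (univ.filter fun x => e false x ∉ B).map (e false)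
      set B1 := (univ.filter fun x => e true x ∈ B).map (e true)
      set Bc1 := (univ.filter fun x => e true x ∉ B).map (e true)
      set Q0 : Finset (Fin (n + 1) → Bool) := univ.map (e false)
      set Q1 : Finset (Fin (n + 1) → Bool) := univ.map (e true)
      -- every vertex of the big cube is `e (σ 0) (tail σ)`
      have dec : ∀ σ : Fin (n + 1) → Bool, σ = e (σ 0) (Fin.tail σ) := by
        intro σ; ext i; refine Fin.cases ?_ (fun i => ?_) i <;> simp [he, Fin.tail]
      have memB : ∀ σ, σ ∈ B → σ ∈ (if σ 0 then B1 else B0) := by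
        intro σ hσ
        rcases Bool.eq_false_or_eq_true (σ 0) with h0' | h0'
        · rw [if_pos h0']
          simp only [B1, mem_map, mem_filter, mem_univ, true_and]
          refine ⟨Fin.tail σ, ?_, ?_⟩
          · have := dec σ; rw [h0'] at this; rw [← this]; exact hσ
          · have := dec σ; rw [h0'] at this; exact this.symm
        · rw [if_neg (by simp [h0'])]
          simp only [B0, mem_map, mem_filter, mem_univ, true_and]
          refine ⟨Fin.tail σ, ?_, ?_⟩
          · have := dec σ; rw [h0'] at this; rw [← this]; exact hσ
          · have := dec σ; rw [h0'] at this; exact this.symm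
      have memBc : ∀ σ, σ ∉ B → σ ∈ (if σ 0 then Bc1 else Bc0) := by
        intro σ hσ
        rcases Bool.eq_false_or_eq_true (σ 0) with h0' | h0'
        · rw [if_pos h0']
          simp only [Bc1, mem_map, mem_filter, mem_univ, true_and]
          refine ⟨Fin.tail σ, ?_, ?_⟩
          · have := dec σ; rw [h0'] at this; rw [← this]; exact hσ
          · have := dec σ; rw [h0'] at this; exact this.symm
        · rw [if_neg (by simp [h0'])]
          simp only [Bc0, mem_map, mem_filter, mem_univ, true_and]
          refine ⟨Fin.tail σ, ?_, ?_⟩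
          · have := dec σ; rw [h0'] at this; rw [← this]; exact hσ
          · have := dec σ; rw [h0'] at this; exact this.symm
      have memQ : ∀ σ : Fin (n + 1) → Bool, σ ∈ (if σ 0 then Q1 else Q0) := by
        intro σ
        rcases Bool.eq_false_or_eq_true (σ 0) with h0' | h0'
        · rw [if_pos h0']
          simp only [Q1, mem_map, mem_univ, true_and]
          exact ⟨Fin.tail σ, by have := dec σ; rw [h0'] at this; exact this.symm⟩
        · rw [if_neg (by simp [h0'])]
          simp only [Q0, mem_map, mem_univ, true_and]
          exact ⟨Fin.tail σ, by have := dec σ; rw [h0'] at this; exact this.symm⟩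
      -- nonnegativity
      have hnn : ∀ A, 0 ≤ h A := fun A => by have := hmono ∅ A (empty_subset _); rw [h0] at this; exact this
      -- L1: h B ≤ h B0 + h B1
      have L1 : h B ≤ h B0 + h B1 := by
        have s1 : B ⊆ B0 ∪ B1 := by
          intro σ hσ; have := memB σ hσ
          rw [mem_union]; split_ifs at this
          · exact Or.inr this
          · exact Or.inl this
        have := hmono _ _ s1; have := hsub B0 B1; have := hnn (B0 ∩ B1); linarith
      have L2 : h Bᶜ ≤ h Bc0 + h Bc1 := by
        have s1 : Bᶜ ⊆ Bc0 ∪ Bc1 := by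
          intro σ hσ; rw [mem_compl] at hσ; have := memBc σ hσ
          rw [mem_union]; split_ifs at this
          · exact Or.inr this
          · exact Or.inl this
        have := hmono _ _ s1; have := hsub Bc0 Bc1; have := hnn (Bc0 ∩ Bc1); linarith
      have L3 : h univ + h B ≤ h (B1 ∪ Q0) + h (B0 ∪ Q1) := by
        have s1 : univ ⊆ (B1 ∪ Q0) ∪ (B0 ∪ Q1) := by
          intro σ _; have := memQ σ
          simp only [mem_union]; split_ifs at this
          · exact Or.inr (Or.inr this)
          · exact Or.inl (Or.inr this)
        have s2 : B ⊆ (B1 ∪ Q0) ∩ (B0 ∪ Q1) := by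
          intro σ hσ; have hq := memQ σ; have hb := memB σ hσ
          simp only [mem_inter, mem_union]; split_ifs at hq hb
          · exact ⟨Or.inl hb, Or.inr hq⟩
          · exact ⟨Or.inr hq, Or.inl hb⟩
        have := hmono _ _ s1; have := hmono _ _ s2; have := hsub (B1 ∪ Q0) (B0 ∪ Q1); linarith
      have L4 : h univ + h Bᶜ ≤ h (Bc1 ∪ Q0) + h (Bc0 ∪ Q1) := by
        have s1 : univ ⊆ (Bc1 ∪ Q0) ∪ (Bc0 ∪ Q1) := by
          intro σ _; have := memQ σ
          simp only [mem_union]; split_ifs at this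
          · exact Or.inr (Or.inr this)
          · exact Or.inl (Or.inr this)
        have s2 : Bᶜ ⊆ (Bc1 ∪ Q0) ∩ (Bc0 ∪ Q1) := by
          intro σ hσ; rw [mem_compl] at hσ; have hq := memQ σ; have hb := memBc σ hσ
          simp only [mem_inter, mem_union]; split_ifs at hq hb
          · exact ⟨Or.inl hb, Or.inr hq⟩
          · exact ⟨Or.inr hq, Or.inl hb⟩
        have := hmono _ _ s1; have := hmono _ _ s2; have := hsub (Bc1 ∪ Q0) (Bc0 ∪ Q1); linarith
      -- the last coordinate's half-spaces contain `Q0`, `Q1`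
      have L5 : h Q0 ≤ h (univ.filter fun σ : Fin (n + 1) → Bool => σ 0 = false) := by
        apply hmono; intro σ hσ
        simp only [Q0, mem_map, mem_univ, true_and] at hσ
        obtain ⟨x, rfl⟩ := hσ
        simp [he]
      have L6 : h Q1 ≤ h (univ.filter fun σ : Fin (n + 1) → Bool => σ 0 = true) := by
        apply hmono; intro σ hσ
        simp only [Q1, mem_map, mem_univ, true_and] at hσ
        obtain ⟨x, rfl⟩ := hσ
        simp [he]
      rw [Fin.sum_univ_succ]
      push_cast
      linarith [E0, E1, L1, L2, L3, L4, L5, L6]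

end Summit.PneNP.PneNP.Theorems.CnfIdealGenLengthRankDefectRepresentationsCutLemmaCutDomination
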